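import Mathlib
import Summits.MatrixMultiplication.MatrixMultiplication.Theorems.ThinBlockAlphaThinPackingsOrbitCriterion

set_option linter.dupNamespace false

/-!
# Orbit designs for `ThinPackings`: the solution count (stub `stub_solCount`)

Line `automorphism-orbit-twisted-templates` (skeleton `Ideator4Sketch`) of crux
`ThinBlockAlpha.ThinPackings` (stmt-MatrixMultiplication-10595), lemma F5 of the Fourier cap.

For an orbit design — a finite group `Γ` acting on a finite abelian `H` by additive automorphisms and
a template `(A, B, C)` that is TPP (`TemplateTPP`) and `Γ`-twisted sum-free (`TwistedSumFree`) —
let `X = {g • (a − b)}`, `Y = {g • (b − c)}`, `Z = {g • (c − a)}` be the `Γ`-saturated difference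
sets.  Then the number of triples `(x, y, z) ∈ X × Y × Z` with `x + y + z = 0` is at most
`|Γ| · |A| · |B| · |C|`.

Proof.  A solution `g • (a − b) + h • (b' − c) + k • (c' − a') = 0` becomes, after dividing by `k`,
`(k⁻¹g) • (a − b) + (k⁻¹h) • (b' − c) + (c' − a') = 0`; twisted sum-freeness forces
`(k⁻¹g, k⁻¹h) = (1, 1)`, i.e. `g = h = k`, and then the relation is the TPP relation
`(a − a') + (b' − b) + (c' − c) = 0`, so `a' = a`, `b' = b`, `c' = c` (`solution_rigid`).  Hence every
solution is `((k • (a − b), k • (b − c)), k • (c − a))` for some `(k, a, b, c) ∈ Γ × A × B × C`: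
the solution set lies in the image of a set of cardinality `|Γ|·|A|·|B|·|C|`.
-/

namespace Summit.MatrixMultiplication.MatrixMultiplication.Theorems.ThinPackings.Orbit

open Finset

section Rigid

variable {Γ H : Type} [Group Γ] [AddCommGroup H] [DistribMulAction Γ H]

/-- **Rigidity of solutions.**  In an orbit design, a vanishing saturated cross sum
`g • (a − b) + h • (b' − c) + k • (c' − a') = 0` (`a, a' ∈ A`, `b, b' ∈ B`, `c, c' ∈ C`) has equal
labels `g = h = k` and paired template elements `a' = a`, `b' = b`, `c' = c`. -/
theorem solution_rigid (A B C : Finset H) (hT : TemplateTPP A B C) (hTw : TwistedSumFree Γ A B C)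
    {g h k : Γ} {a a' b b' c c' : H} (ha : a ∈ A) (ha' : a' ∈ A) (hb : b ∈ B) (hb' : b' ∈ B)
    (hc : c ∈ C) (hc' : c' ∈ C) (hrel : g • (a - b) + h • (b' - c) + k • (c' - a') = 0) :
    g = k ∧ h = k ∧ a' = a ∧ b' = b ∧ c' = c := by
  -- divide the relation by `k`
  have key : (k⁻¹ * g) • (a - b) + (k⁻¹ * h) • (b' - c) + (c' - a') = 0 := by
    have e := congrArg (fun v : H => k⁻¹ • v) hrel
    simpa only [smul_add, smul_zero, ← mul_smul, inv_mul_cancel, one_smul] using e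
  -- twisted sum-freeness forces both quotient labels to be `1`
  have h1 : (k⁻¹ * g, k⁻¹ * h) = ((1 : Γ), (1 : Γ)) := by
    by_contra hne
    exact hTw _ _ hne a ha b hb b' hb' c hc c' hc' a' ha' key
  rw [Prod.mk.injEq] at h1
  obtain ⟨hg1, hh1⟩ := h1
  rw [hg1, hh1, one_smul, one_smul] at key
  -- now the relation is the TPP relation of the template
  have e : a - a' + (b' - b) + (c' - c) = a - b + (b' - c) + (c' - a') := by abel
  obtain ⟨haa, hbb, hcc⟩ := hT a' ha' a ha b hb b' hb' c hc c' hc' (e.trans key)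
  exact ⟨(inv_mul_eq_one.mp hg1).symm, (inv_mul_eq_one.mp hh1).symm, haa, hbb.symm, hcc.symm⟩

end Rigid

/-- **Registered stub `stub_solCount`** of the line's skeleton (crux stmt-MatrixMultiplication-10595),
verbatim — lemma F5 (solution count of an orbit design): with `X, Y, Z` the `Γ`-saturated difference
sets of a TPP, `Γ`-twisted sum-free template `(A, B, C)`, the number of `(x, y, z) ∈ X × Y × Z` with
`x + y + z = 0` is at most `|Γ|·|A|·|B|·|C|` (the solution set lies in the image of `Γ × A × B × C`
under `(k, a, b, c) ↦ ((k • (a − b), k • (b − c)), k • (c − a))`, by `solution_rigid`).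
[new, elementary] -/
theorem stub_solCount : ∀ {Γ H : Type} [Group Γ] [Fintype Γ] [AddCommGroup H] [Fintype H] [DecidableEq H] [DistribMulAction Γ H] (A B C : Finset H), TemplateTPP A B C → TwistedSumFree Γ A B C → (((((univ : Finset Γ) ×ˢ (A ×ˢ B)).image fun p => p.1 • (p.2.1 - p.2.2)) ×ˢ (((univ : Finset Γ) ×ˢ (B ×ˢ C)).image fun p => p.1 • (p.2.1 - p.2.2))) ×ˢ (((univ : Finset Γ) ×ˢ (C ×ˢ A)).image fun p => p.1 • (p.2.1 - p.2.2)) |>.filter fun t => t.1.1 + t.1.2 + t.2 = 0).card ≤ Fintype.card Γ * (A.card * B.card * C.card) := by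
  intro Γ H _ _ _ _ _ _ A B C hT hTw
  -- the solution set lies in the image of `Γ × ((A × B) × C)` under the parametrisation
  refine (card_le_card (t := ((univ : Finset Γ) ×ˢ ((A ×ˢ B) ×ˢ C)).image
      fun q : Γ × ((H × H) × H) =>
        ((q.1 • (q.2.1.1 - q.2.1.2), q.1 • (q.2.1.2 - q.2.2)), q.1 • (q.2.2 - q.2.1.1))) ?_).trans
    (card_image_le.trans_eq (by rw [card_product, card_product, card_product, card_univ]))
  rintro ⟨⟨x, y⟩, z⟩ ht
  rw [mem_filter, mem_product, mem_product] at ht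
  obtain ⟨⟨⟨hx, hy⟩, hz⟩, hrel⟩ := ht
  rw [mem_image] at hx hy hz
  obtain ⟨⟨g, a, b⟩, hgab, rfl⟩ := hx
  obtain ⟨⟨h, b', c⟩, hhbc, rfl⟩ := hy
  obtain ⟨⟨k, c', a'⟩, hkca, rfl⟩ := hz
  simp only [mem_product, mem_univ, true_and] at hgab hhbc hkca
  obtain ⟨ha, hb⟩ := hgab
  obtain ⟨hb', hc⟩ := hhbc
  obtain ⟨hc', ha'⟩ := hkca
  dsimp only at hrel ⊢
  obtain ⟨hgk, hhk, haa, hbb, hcc⟩ :=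
    solution_rigid A B C hT hTw ha ha' hb hb' hc hc' hrel
  rw [mem_image]
  refine ⟨(k, ((a, b), c)), ?_, ?_⟩
  · simp only [mem_product, mem_univ, true_and]
    exact ⟨⟨ha, hb⟩, hc⟩
  · simp only [hgk, hhk, haa, hbb, hcc]

end Summit.MatrixMultiplication.MatrixMultiplication.Theorems.ThinPackings.Orbit
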